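import Mathlib

/-! # Decomp6Indec — the basis multisets of `Decomp6` are indecomposable (seat p4 g3)

Companion of `Decomp6.lean` (same encoding: sign vectors in `{±1}^3` as indices `i < 8`, conjugate `7 - i`; `ZeroSum` = (eq2)).
For each of the `6` basis multisets `b` (antipodal pairs, faces): every zero-sum sub-multiset `c ≤ b` is `0` or `b`.
With `Decomp6.domination` (every nonzero zero-sum multiset dominates a basis element) this says the indecomposable
zero-sum multisets are EXACTLY the basis multisets, for every size. -/

namespace HodgeRepro.P4.Decomp6Indec

/-- (eq2): the multiset `n0 … n7` has zero sum in each coordinate (same as `Decomp6.ZeroSum`). -/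
abbrev ZeroSum (n0 n1 n2 n3 n4 n5 n6 n7 : ℕ) : Prop :=
  n1 + n3 + n5 + n7 = n0 + n2 + n4 + n6 ∧
  n2 + n3 + n6 + n7 = n0 + n1 + n4 + n5 ∧
  n4 + n5 + n6 + n7 = n0 + n1 + n2 + n3

/-- `pair0` = `{0, 7}` is indecomposable. -/
theorem indec_pair0 (c0 c7 : ℕ) (_hle : c0 ≤ 1 ∧ c7 ≤ 1) (hz : ZeroSum c0 0 0 0 0 0 0 c7) :
    (c0 = 0 ∧ c7 = 0) ∨ (c0 = 1 ∧ c7 = 1) := by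
  obtain ⟨_h0, _h1, _h2⟩ := hz
  omega

/-- `pair1` = `{1, 6}` is indecomposable. -/
theorem indec_pair1 (c1 c6 : ℕ) (_hle : c1 ≤ 1 ∧ c6 ≤ 1) (hz : ZeroSum 0 c1 0 0 0 0 c6 0) :
    (c1 = 0 ∧ c6 = 0) ∨ (c1 = 1 ∧ c6 = 1) := by
  obtain ⟨_h0, _h1, _h2⟩ := hz
  omega

/-- `pair2` = `{2, 5}` is indecomposable. -/
theorem indec_pair2 (c2 c5 : ℕ) (_hle : c2 ≤ 1 ∧ c5 ≤ 1) (hz : ZeroSum 0 0 c2 0 0 c5 0 0) :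
    (c2 = 0 ∧ c5 = 0) ∨ (c2 = 1 ∧ c5 = 1) := by
  obtain ⟨_h0, _h1, _h2⟩ := hz
  omega

/-- `pair3` = `{3, 4}` is indecomposable. -/
theorem indec_pair3 (c3 c4 : ℕ) (_hle : c3 ≤ 1 ∧ c4 ≤ 1) (hz : ZeroSum 0 0 0 c3 c4 0 0 0) :
    (c3 = 0 ∧ c4 = 0) ∨ (c3 = 1 ∧ c4 = 1) := by
  obtain ⟨_h0, _h1, _h2⟩ := hz
  omega

/-- `face0` = `{0, 3, 5, 6}` is indecomposable. -/
theorem indec_face0 (c0 c3 c5 c6 : ℕ) (_hle : c0 ≤ 1 ∧ c3 ≤ 1 ∧ c5 ≤ 1 ∧ c6 ≤ 1) (hz : ZeroSum c0 0 0 c3 0 c5 c6 0) :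
    (c0 = 0 ∧ c3 = 0 ∧ c5 = 0 ∧ c6 = 0) ∨ (c0 = 1 ∧ c3 = 1 ∧ c5 = 1 ∧ c6 = 1) := by
  obtain ⟨_h0, _h1, _h2⟩ := hz
  omega

/-- `face1` = `{1, 2, 4, 7}` is indecomposable. -/
theorem indec_face1 (c1 c2 c4 c7 : ℕ) (_hle : c1 ≤ 1 ∧ c2 ≤ 1 ∧ c4 ≤ 1 ∧ c7 ≤ 1) (hz : ZeroSum 0 c1 c2 0 c4 0 0 c7) :
    (c1 = 0 ∧ c2 = 0 ∧ c4 = 0 ∧ c7 = 0) ∨ (c1 = 1 ∧ c2 = 1 ∧ c4 = 1 ∧ c7 = 1) := by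
  obtain ⟨_h0, _h1, _h2⟩ := hz
  omega

end HodgeRepro.P4.Decomp6Indec
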